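import Literature.MathematicalPhysics.QuantumFieldTheory.BalabanFormatDensity
import Literature.RepresentationTheory.CompactGroups.UnitaryTrick

/-!
# Parity covariance of the uneven axial blocking

Crux `LuscherReduction.TwistedTraceScaling` (stmt-QuantumFields-20203), crux idea
`parity-valley-regularity` (ideator 2), CHECK ITEM «exact parity of every blocked Wilson theory of
the E1 tower»; disprover's pre-vet `Cruxes/TwistedTraceScaling/Disproof.lean` rev 7 §J (V7):
«the parity card's CHECK ITEM also holds for the tree's uneven blocking (`unevenLen`: side-word
`b^{T−1}·(N − b(T−1))`, ONE odd block — reflection axis through its middle) … a blocked theory built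
on a side-word WITHOUT a dihedral axis would lose exact parity — the only way (β)'s «evenness for
free» can fail, and a pure combinatorial guard for the planner».  This file makes that guard a
THEOREM for the tree's blocking map `unevenAxialLink b N T` (any dimension `d`, any group `G`,
regime `b (T-1) ≤ N` = the regime of gauge covariance / tiling in `UnevenAxialBlocking`).

## Content (everything proved, no `sorry`, no new axioms)

* `siteReflect L ν a x` — reflection of the torus of side `L` in the axis direction `ν`:
  `x_ν ↦ a − x_ν`, other coordinates fixed;
* `linkReflect L ν a U` — the induced PARITY of a gauge field: links pointing in direction `ν` are
  reversed, `(πU)(x, ν) = U(σx − e_ν, ν)⁻¹`, links pointing in `μ ≠ ν` are carried along,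
  `(πU)(x, μ) = U(σx, μ)`;
* `transport_linkReflect_of_ne` / `transport_linkReflect_self` — straight transporters of `πU`:
  carried along for `μ ≠ ν`, INVERTED straight transporter of the reflected path for `μ = ν`;
* ★ `unevenAxialLink_linkReflect` — **the uneven axial blocking intertwines the parities**:
  for `b (T-1) ≤ N`,
  `unevenAxialLink b N T (linkReflect N ν (b(T-1)) U) = linkReflect T ν (T-1) (unevenAxialLink b N T U)`.
  The fine axis is `x_ν ↦ b(T−1) − x_ν` (it maps the set of block corners `{0, b, …, b(T−1)}` to
  itself and the odd last arc `[b(T−1), N]` to itself), the block axis is `y_ν ↦ T − 1 − y_ν`.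
* `linkReflect_linkReflect` — parity is an involution (so the intertwining is an equivariance for
  an action of `ℤ/2`); `linkReflect_zero_one_eq_timeReflect` — for `ν = 0`, `a = 1` it IS the
  tree's Osterwalder–Seiler reflection `GaugeConfig.timeReflect`.
* ★ `wilsonAction_linkReflect` — the Wilson action of any continuous matrix representation of a
  compact `G` is parity invariant (plaquettes are permuted by the involution `plaqReflect`; those
  containing `ν` pick up a conjugate-inverse holonomy, same real trace by the unitary trick).
* Part II (measure level, over the tree's `torusLinkHaar` and Bałaban's renormalization
  transformation in the weak form `HasBlockedDensity` of `BalabanFormatDensity`):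
  `measurePreserving_linkReflect` (parity preserves `∏ₑ dU_e`); the abstract transfer lemmas
  `hasBlockedDensity_self_of_semiconj` / `hasBlockedDensity_comp_of_semiconj` (a blocking that
  intertwines a measure- and weight-preserving symmetry pushes to a symmetric blocked density);
  ★★ `hasBlockedDensity_unevenAxialLink_parity` and the unconditional Wilson case
  `hasBlockedDensity_wilson_parity`: for `b (T-1) ≤ N`, EVERY blocked density `σ` of the Wilson
  weight through `unevenAxialLink b N T` has a parity-invariant block measure `σ dV`, and `σ ∘ π_T`
  is again a blocked density — in every axis direction `ν`.

Consequence for the line: every blocked Gibbs factor of the E1 tower built with `unevenAxialLink`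
(in particular Bałaban's small-field effective actions as functions of the block field, and their
last-scale background dependence along the toron valley, `A_ν ↦ -A_ν` under the parity in direction
`ν`) is EXACTLY EVEN — the input (B1) of the card, now a theorem at the level of blocked densities
(pointwise evenness of a chosen representative: symmetrise `σ ↦ (σ + σ ∘ π_T)/2`, routine).  A
blocking whose side-word has no dihedral axis admits no such intertwiner.

HONEST FRAMING: combinatorial bookkeeping for a module of a stub of a child of a CONDITIONAL reduction
route (femto rung R2b1); nothing of the RG content (W-REP/W-CMP/W-FLOW), not a gap, not Clay.
-/

noncomputable section

open Literature.MathematicalPhysics.QuantumLattice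
open Literature.MathematicalPhysics.QuantumFieldTheory

namespace Summit.QuantumFields.YangMills.Cruxes.TwistedTraceScaling.ParityBlocking

variable {d : ℕ} {G : Type*}

/-! ### Axis reflections of sites and the induced parity of gauge fields -/

/-- Reflection of the discrete torus of side `L` in the axis direction `ν` about `a/2`:
`x_ν ↦ a − x_ν`, the other coordinates unchanged. -/
def siteReflect (L : ℕ) (ν : Fin d) (a : ZMod L) (x : Site d L) : Site d L :=
  Function.update x ν (a - x ν)

/-- **Parity of a gauge field** under the axis reflection `siteReflect L ν a`: a link in direction
`ν` from `x` to `x + e_ν` is mapped to the link from `σx − e_ν` to `σx`, traversed BACKWARDS, so its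
variable is inverted; links in directions `μ ≠ ν` are carried along. -/
def linkReflect [Group G] (L : ℕ) (ν : Fin d) (a : ZMod L) (U : GaugeConfig d L G) :
    GaugeConfig d L G :=
  fun e => if e.2 = ν then (U (siteReflect L ν (a - 1) e.1, ν))⁻¹ else U (siteReflect L ν a e.1, e.2)

variable {L : ℕ} (ν : Fin d) (a : ZMod L)

@[simp] theorem siteReflect_apply_self (x : Site d L) : siteReflect L ν a x ν = a - x ν := by
  simp [siteReflect]

theorem siteReflect_apply_of_ne {i : Fin d} (hi : i ≠ ν) (x : Site d L) :
    siteReflect L ν a x i = x i := by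
  simp [siteReflect, hi]

/-- The reflection is an involution. -/
theorem siteReflect_siteReflect (x : Site d L) : siteReflect L ν a (siteReflect L ν a x) = x := by
  funext i
  by_cases hi : i = ν
  · subst hi; simp [siteReflect]
  · simp [siteReflect, hi]

/-- Shifting in a direction `μ ≠ ν` commutes with the reflection in direction `ν`. -/
theorem siteReflect_shift_of_ne {μ : Fin d} (hμ : μ ≠ ν) (x : Site d L) :
    siteReflect L ν a (x.shift μ) = (siteReflect L ν a x).shift μ := by
  funext i
  simp only [Site.shift, siteReflect, Pi.add_apply]
  by_cases hi : i = ν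
  · subst hi
    simp [Ne.symm hμ]
  · simp [hi]

/-- Shifting in direction `ν` LOWERS the reflected coordinate by one. -/
theorem siteReflect_shift_self (x : Site d L) :
    siteReflect L ν a (x.shift ν) = siteReflect L ν (a - 1) x := by
  funext i
  simp only [Site.shift, siteReflect, Pi.add_apply]
  by_cases hi : i = ν
  · subst hi
    simp; ring
  · simp [hi]

theorem linkReflect_apply_self [Group G] (U : GaugeConfig d L G) (x : Site d L) :
    linkReflect L ν a U (x, ν) = (U (siteReflect L ν (a - 1) x, ν))⁻¹ := by
  simp [linkReflect]

theorem linkReflect_apply_of_ne [Group G] (U : GaugeConfig d L G) (x : Site d L) {μ : Fin d}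
    (hμ : μ ≠ ν) : linkReflect L ν a U (x, μ) = U (siteReflect L ν a x, μ) := by
  simp [linkReflect, hμ]

/-- **Parity is an involution** on gauge fields. -/
theorem linkReflect_linkReflect [Group G] (U : GaugeConfig d L G) :
    linkReflect L ν a (linkReflect L ν a U) = U := by
  funext e
  obtain ⟨x, μ⟩ := e
  by_cases hμ : μ = ν
  · subst hμ
    rw [linkReflect_apply_self, linkReflect_apply_self, inv_inv]
    congr 1
    refine Prod.ext ?_ rfl
    funext i
    by_cases hi : i = μ
    · subst hi; simp [siteReflect]
    · simp [siteReflect, hi]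
  · rw [linkReflect_apply_of_ne _ _ _ _ hμ, linkReflect_apply_of_ne _ _ _ _ hμ,
      siteReflect_siteReflect]

/-! ### Straight transporters of the reflected field -/

/-- A straight path in a direction `μ ≠ ν` is carried along by the reflection. -/
theorem transport_linkReflect_of_ne [Group G] (U : GaugeConfig d L G) {μ : Fin d} (hμ : μ ≠ ν)
    (n : ℕ) (c : Site d L) :
    transport (linkReflect L ν a U) c (List.replicate n μ) =
      transport U (siteReflect L ν a c) (List.replicate n μ) := by
  induction n generalizing c with
  | zero => simp
  | succ n ih =>
    rw [List.replicate_succ, transport_cons, transport_cons, ih, linkReflect_apply_of_ne _ _ _ _ hμ,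
      siteReflect_shift_of_ne _ _ hμ]

/-- The endpoint of a straight path of `n` steps in direction `μ`. -/
theorem pathEnd_replicate (c : Site d L) (μ : Fin d) (n : ℕ) :
    pathEnd c (List.replicate n μ) = c + n • (Pi.single μ (1 : ZMod L) : Site d L) := by
  rw [pathEnd_eq_add, List.map_replicate, List.sum_replicate]

/-- A straight path in the reflected direction `ν` is mapped to the reflected path traversed
backwards: the transporter of the reflected field from `c` of `n` steps is the INVERSE of the
transporter of the original field from `σ_{a-n} c` (the reflected endpoint) of `n` steps. -/
theorem transport_linkReflect_self [Group G] (U : GaugeConfig d L G) (n : ℕ) (c : Site d L) :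
    transport (linkReflect L ν a U) c (List.replicate n ν) =
      (transport U (siteReflect L ν (a - n) c) (List.replicate n ν))⁻¹ := by
  induction n generalizing c with
  | zero => simp
  | succ n ih =>
    -- split the LAST link off the original path
    have hsplit : transport U (siteReflect L ν (a - (n + 1 : ℕ)) c) (List.replicate (n + 1) ν) =
        transport U (siteReflect L ν (a - (n + 1 : ℕ)) c) (List.replicate n ν) *
          U (siteReflect L ν (a - 1) c, ν) := by
      rw [List.replicate_succ', transport_append, transport_cons, transport_nil, mul_one,
        pathEnd_replicate]
      congr 2
      refine Prod.ext ?_ rfl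
      funext i
      simp only [Pi.add_apply, Pi.smul_apply, siteReflect]
      by_cases hi : i = ν
      · subst hi
        simp only [Function.update_self, Pi.single_eq_same, nsmul_eq_mul, mul_one]
        push_cast
        ring
      · simp [hi]
    -- the start of the reflected path
    have hstart : siteReflect L ν (a - n - 1) c = siteReflect L ν (a - (n + 1 : ℕ)) c := by
      funext i
      by_cases hi : i = ν
      · subst hi; simp [siteReflect]; ring
      · simp [siteReflect, hi]
    rw [hsplit, mul_inv_rev, List.replicate_succ, transport_cons, ih, linkReflect_apply_self,
      siteReflect_shift_self, hstart]

/-! ### Corner and length bookkeeping of the uneven blocking under the reflections -/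

section Corner

variable {b N T : ℕ}

/-- The value of the reflected block coordinate: no wrap-around, `(T-1-y_ν)`. -/
theorem val_sub_eq [NeZero T] (y : ZMod T) :
    (((T - 1 : ℕ) : ZMod T) - y).val = T - 1 - y.val := by
  have hy : y.val ≤ T - 1 := Nat.le_sub_one_of_lt (ZMod.val_lt y)
  conv_lhs => rw [← ZMod.natCast_zmod_val y, ← Nat.cast_sub hy]
  rw [ZMod.val_natCast]
  exact Nat.mod_eq_of_lt (lt_of_le_of_lt (Nat.sub_le _ _) (Nat.sub_lt (NeZero.pos T) one_pos))

/-- Transverse directions: the reflected corner is the corner of the reflected block site. -/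
theorem siteReflect_unevenCorner [NeZero T] (y : Site d T) :
    siteReflect N ν ((b * (T - 1) : ℕ) : ZMod N) (unevenCorner b N T y) =
      unevenCorner b N T (siteReflect T ν ((T - 1 : ℕ) : ZMod T) y) := by
  funext i
  by_cases hi : i = ν
  · subst hi
    rw [siteReflect_apply_self, unevenCorner_apply, unevenCorner_apply, siteReflect_apply_self,
      val_sub_eq]
    have hv : (y i).val ≤ T - 1 := Nat.le_sub_one_of_lt (ZMod.val_lt _)
    have hsplit : b * (T - 1) = b * (T - 1 - (y i).val) + b * (y i).val := by
      rw [← Nat.mul_add, Nat.sub_add_cancel hv]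
    rw [hsplit]; push_cast; ring
  · rw [siteReflect_apply_of_ne _ _ hi, unevenCorner_apply, unevenCorner_apply,
      siteReflect_apply_of_ne _ _ hi]

/-- Transverse directions: the path length only depends on the coordinate in the path's direction. -/
theorem unevenLen_siteReflect_of_ne (y : Site d T) {μ : Fin d} (hμ : μ ≠ ν) (a : ZMod T) :
    unevenLen b N T (siteReflect T ν a y) μ = unevenLen b N T y μ := by
  simp [unevenLen, siteReflect_apply_of_ne _ _ hμ]

/-- Longitudinal direction, block level: the start site of the reversed block link. -/
theorem blockStart_eq [NeZero T] (y : Site d T) :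
    siteReflect T ν (((T - 1 : ℕ) : ZMod T) - 1) y =
      Function.update y ν (((T - 1 : ℕ) : ZMod T) - 1 - y ν) := rfl

/-- Longitudinal direction: the reversed image of the LAST block is the last block, with the same
length, and the reflected path start is its corner (`b(T-1) − b(T-1) − (N − b(T-1)) ≡ b(T-1)`
modulo `N`). -/
theorem corner_last [NeZero T] (hN : b * (T - 1) ≤ N) (y : Site d T) (h : (y ν).val + 1 = T) :
    ((siteReflect T ν (((T - 1 : ℕ) : ZMod T) - 1) y) ν).val + 1 = T ∧
    siteReflect N ν (((b * (T - 1) : ℕ) : ZMod N) - (unevenLen b N T y ν : ℕ)) (unevenCorner b N T y) =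
      unevenCorner b N T (siteReflect T ν (((T - 1 : ℕ) : ZMod T) - 1) y) := by
  have hyv : (y ν).val = T - 1 := by omega
  have hy : y ν = ((T - 1 : ℕ) : ZMod T) := by rw [← hyv, ZMod.natCast_zmod_val]
  have hrefl : (siteReflect T ν (((T - 1 : ℕ) : ZMod T) - 1) y) ν = ((T - 1 : ℕ) : ZMod T) := by
    rw [siteReflect_apply_self, hy, sub_sub_cancel_left, neg_eq_iff_add_eq_zero]
    have : ((T - 1 : ℕ) : ZMod T) + 1 = ((T - 1 + 1 : ℕ) : ZMod T) := by push_cast; ring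
    rw [add_comm, this, Nat.sub_add_cancel (NeZero.pos T), ZMod.natCast_self]
  have hval : (((T - 1 : ℕ) : ZMod T)).val = T - 1 := by
    rw [ZMod.val_natCast, Nat.mod_eq_of_lt (Nat.sub_lt (NeZero.pos T) one_pos)]
  refine ⟨by rw [hrefl, hval]; omega, ?_⟩
  funext i
  by_cases hi : i = ν
  · subst hi
    rw [siteReflect_apply_self, unevenCorner_apply, unevenCorner_apply, hrefl, hval, hyv,
      unevenLen_of_eq h, sub_sub_cancel_left, Nat.cast_sub hN, neg_sub, sub_eq_self,
      ZMod.natCast_self]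
  · rw [siteReflect_apply_of_ne _ _ hi, unevenCorner_apply, unevenCorner_apply,
      siteReflect_apply_of_ne _ _ hi]

/-- Longitudinal direction: the reversed image of the block `y_ν = k ≤ T-2` is the block
`T - 2 - k` (not the last one), with the same length `b`, and the reflected path start is its corner
(`b(T-1) − bk − b = b(T-2-k)`). -/
theorem corner_notLast [NeZero T] (y : Site d T) (h : (y ν).val + 1 ≠ T) :
    ((siteReflect T ν (((T - 1 : ℕ) : ZMod T) - 1) y) ν).val + 1 ≠ T ∧
    siteReflect N ν (((b * (T - 1) : ℕ) : ZMod N) - (unevenLen b N T y ν : ℕ)) (unevenCorner b N T y) =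
      unevenCorner b N T (siteReflect T ν (((T - 1 : ℕ) : ZMod T) - 1) y) := by
  have hlt : (y ν).val + 1 < T := lt_of_le_of_ne (ZMod.val_lt (y ν)) h
  set k := (y ν).val with hk
  have hy : y ν = (k : ZMod T) := (ZMod.natCast_zmod_val (y ν)).symm
  have hk2 : k + 2 ≤ T := hlt
  have hrefl : (siteReflect T ν (((T - 1 : ℕ) : ZMod T) - 1) y) ν = ((T - 2 - k : ℕ) : ZMod T) := by
    rw [siteReflect_apply_self, hy]
    have : ((T - 1 : ℕ) : ZMod T) = ((T - 2 - k : ℕ) : ZMod T) + 1 + (k : ZMod T) := by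
      have h' : T - 1 = (T - 2 - k) + 1 + k := by omega
      rw [h']; push_cast; ring
    rw [this]; ring
  have hval : (((T - 2 - k : ℕ) : ZMod T)).val = T - 2 - k := by
    rw [ZMod.val_natCast, Nat.mod_eq_of_lt (by omega)]
  refine ⟨by rw [hrefl, hval]; omega, ?_⟩
  funext i
  by_cases hi : i = ν
  · subst hi
    rw [siteReflect_apply_self, unevenCorner_apply, unevenCorner_apply, hrefl, hval, ← hk,
      unevenLen_of_ne h]
    have h' : b * (T - 1) = b * (T - 2 - k) + b + b * k := by
      have : T - 1 = (T - 2 - k) + 1 + k := by omega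
      rw [this]; ring
    rw [h']; push_cast; ring
  · rw [siteReflect_apply_of_ne _ _ hi, unevenCorner_apply, unevenCorner_apply,
      siteReflect_apply_of_ne _ _ hi]

end Corner

/-! ### The intertwining theorem -/

/-- ★ **Parity covariance of the uneven axial blocking.**  For `b (T-1) ≤ N` the uneven axial
blocking `Ū = unevenAxialLink b N T` of a torus of side `N` to the block torus of side `T`
INTERTWINES the parity of the fine torus in the axis direction `ν` about `b(T-1)/2` (which maps the
block corners `0, b, …, b(T-1)` to themselves and the odd last arc `[b(T-1), N]` onto itself) with
the parity of the block torus about `(T-1)/2`:  `Ū(π_N U) = π_T(Ū U)` — exactly, for every gauge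
field, in every dimension and for every group.  (This is the dihedral axis through the middle of the
ONE odd block of the side-word `b^{T-1}·(N − b(T−1))`; the even blocking `N = b·T` is included.) -/
theorem unevenAxialLink_linkReflect [Group G] {b N T : ℕ} [NeZero T] (hN : b * (T - 1) ≤ N)
    (ν : Fin d) (U : GaugeConfig d N G) :
    unevenAxialLink b N T (linkReflect N ν ((b * (T - 1) : ℕ) : ZMod N) U) =
      linkReflect T ν ((T - 1 : ℕ) : ZMod T) (unevenAxialLink b N T U) := by
  funext e
  obtain ⟨y, μ⟩ := e
  simp only [unevenAxialLink_apply]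
  by_cases hμ : μ = ν
  · subst hμ
    rw [linkReflect_apply_self, unevenAxialLink_apply, transport_linkReflect_self]
    -- the reflected start is the corner of the image block, whose length is the same
    by_cases h : (y μ).val + 1 = T
    · obtain ⟨hlast, hcorner⟩ := corner_last (ν := μ) hN y h
      rw [hcorner, unevenLen_of_eq h, unevenLen_of_eq hlast]
    · obtain ⟨hnot, hcorner⟩ := corner_notLast (b := b) (N := N) (ν := μ) y h
      rw [hcorner, unevenLen_of_ne h, unevenLen_of_ne hnot]
  · rw [linkReflect_apply_of_ne _ _ _ _ hμ, unevenAxialLink_apply,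
      transport_linkReflect_of_ne _ _ _ hμ, siteReflect_unevenCorner,
      unevenLen_siteReflect_of_ne _ _ hμ]

/-- The same statement read as an EQUIVARIANCE: blocking the reflected field and reflecting back
gives the blocked field. -/
theorem linkReflect_unevenAxialLink_linkReflect [Group G] {b N T : ℕ} [NeZero T]
    (hN : b * (T - 1) ≤ N) (ν : Fin d) (U : GaugeConfig d N G) :
    linkReflect T ν ((T - 1 : ℕ) : ZMod T)
        (unevenAxialLink b N T (linkReflect N ν ((b * (T - 1) : ℕ) : ZMod N) U)) =
      unevenAxialLink b N T U := by
  rw [unevenAxialLink_linkReflect hN, linkReflect_linkReflect]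

/-- Pull-back form: a function of the block field that is EVEN under the block parity pulls back
along the blocking to a function of the fine field that is even under the fine parity — the shape in
which «evenness for free» is consumed (blocked densities / effective actions as functions of the
block field). -/
theorem comp_unevenAxialLink_even [Group G] {b N T : ℕ} [NeZero T] (hN : b * (T - 1) ≤ N)
    (ν : Fin d) {α : Type*} {F : GaugeConfig d T G → α}
    (hF : ∀ V, F (linkReflect T ν ((T - 1 : ℕ) : ZMod T) V) = F V) (U : GaugeConfig d N G) :
    F (unevenAxialLink b N T (linkReflect N ν ((b * (T - 1) : ℕ) : ZMod N) U)) =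
      F (unevenAxialLink b N T U) := by
  rw [unevenAxialLink_linkReflect hN, hF]


/-! ### Consistency with the tree's Osterwalder–Seiler reflection -/

/-- In the time direction `ν = 0` about `a = 1` the parity IS the tree's Osterwalder–Seiler
reflection `GaugeConfig.timeReflect` (hyperplane between the slices `0 | 1`), whose plaquette
covariance is `plaqRe_timeReflect` (file `ConstructiveQFTWave0Proofs`). -/
theorem linkReflect_zero_one_eq_timeReflect [Group G] [NeZero d] (U : GaugeConfig d L G) :
    linkReflect L 0 1 U = U.timeReflect := by
  funext e
  obtain ⟨x, μ⟩ := e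
  have hσ : ∀ y : Site d L, y.timeReflect = siteReflect L 0 1 y := fun _ => rfl
  by_cases hμ : μ = 0
  · subst hμ
    simp only [linkReflect, GaugeConfig.timeReflect, if_true, hσ, siteReflect_shift_self]
  · simp only [linkReflect, GaugeConfig.timeReflect, hμ, if_false, hσ]

/-! ### The Wilson action is parity invariant -/

section Wilson

variable [Group G]

/-- `σ_a = (· + e_ν) ∘ σ_{a-1}`. -/
theorem siteReflect_eq_shift (x : Site d L) :
    siteReflect L ν a x = (siteReflect L ν (a - 1) x).shift ν := by
  funext i
  simp only [Site.shift, siteReflect, Pi.add_apply]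
  by_cases hi : i = ν
  · subst hi; simp; ring
  · simp [hi]

/-- The induced map of plaquettes: a plaquette containing the direction `ν` goes to the reflected
plaquette (corner `σ_{a-1} x`, same plane), one orthogonal to `ν` is carried along (corner `σ_a x`). -/
def plaqReflect (L : ℕ) (ν : Fin d) (a : ZMod L) (p : Plaquette d L) : Plaquette d L :=
  (if p.2.1.1 = ν ∨ p.2.1.2 = ν then siteReflect L ν (a - 1) p.1 else siteReflect L ν a p.1, p.2)

theorem plaqReflect_plaqReflect (p : Plaquette d L) :
    plaqReflect L ν a (plaqReflect L ν a p) = p := by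
  obtain ⟨x, q⟩ := p
  simp only [plaqReflect]
  split_ifs <;> simp [siteReflect_siteReflect]

/-- `plaqReflect` as a permutation of the plaquettes (an involution). -/
def plaqReflectEquiv (L : ℕ) (ν : Fin d) (a : ZMod L) : Equiv.Perm (Plaquette d L) :=
  Function.Involutive.toPerm (plaqReflect L ν a) (plaqReflect_plaqReflect ν a)

open Literature.RepresentationTheory.CompactGroups in
/-- `Re tr ρ((πU)_p) = Re tr ρ(U_{ϑp})`: the holonomy of the reflected field around `p` is the
holonomy of `U` around the reflected plaquette (planes orthogonal to `ν`) or a conjugate of its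
inverse (planes containing `ν`); real traces of a continuous representation of the compact group
agree on `g` and `g⁻¹` (`CompactGroup.re_trace_map_inv`, unitary trick). -/
theorem re_trace_plaquetteHolonomy_linkReflect [TopologicalSpace G] [IsTopologicalGroup G]
    [CompactSpace G] {n : ℕ} (ρ : G →* Matrix (Fin n) (Fin n) ℂ) (hρ : Continuous ρ)
    (U : GaugeConfig d L G) (p : Plaquette d L) :
    (ρ (plaquetteHolonomy (linkReflect L ν a U) p.1 p.2.1.1 p.2.1.2)).trace.re =
      (ρ (plaquetteHolonomy U (plaqReflect L ν a p).1 (plaqReflect L ν a p).2.1.1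
        (plaqReflect L ν a p).2.1.2)).trace.re := by
  obtain ⟨x, ⟨⟨i, j⟩, hij⟩⟩ := p
  simp only [plaqReflect]
  by_cases hi : i = ν
  · subst hi
    have hj : j ≠ i := (ne_of_lt hij).symm
    rw [if_pos (Or.inl rfl)]
    unfold plaquetteHolonomy
    rw [linkReflect_apply_self, linkReflect_apply_of_ne _ _ _ _ hj, linkReflect_apply_self,
      linkReflect_apply_of_ne _ _ _ _ hj, siteReflect_shift_self, siteReflect_shift_of_ne _ _ hj,
      siteReflect_eq_shift i a x]
    set y := siteReflect L i (a - 1) x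
    rw [show (U (y, i))⁻¹ * U (y, j) * ((U (y.shift j, i))⁻¹)⁻¹ * (U (y.shift i, j))⁻¹ =
        (U (y, i))⁻¹ * (U (y, i) * U (y.shift i, j) * (U (y.shift j, i))⁻¹ * (U (y, j))⁻¹)⁻¹ *
          ((U (y, i))⁻¹)⁻¹ by group,
      CompactGroup.trace_conj_eq, CompactGroup.re_trace_map_inv ρ hρ]
  · by_cases hj : j = ν
    · subst hj
      rw [if_pos (Or.inr rfl)]
      unfold plaquetteHolonomy
      rw [linkReflect_apply_of_ne _ _ _ _ hi, linkReflect_apply_self,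
        linkReflect_apply_of_ne _ _ _ _ hi, linkReflect_apply_self, siteReflect_shift_of_ne _ _ hi,
        siteReflect_shift_self, siteReflect_eq_shift j a x]
      set y := siteReflect L j (a - 1) x
      rw [show U (y.shift j, i) * (U (y.shift i, j))⁻¹ * (U (y, i))⁻¹ * ((U (y, j))⁻¹)⁻¹ =
          (U (y, j))⁻¹ * (U (y, i) * U (y.shift i, j) * (U (y.shift j, i))⁻¹ * (U (y, j))⁻¹)⁻¹ *
            ((U (y, j))⁻¹)⁻¹ by group,
        CompactGroup.trace_conj_eq, CompactGroup.re_trace_map_inv ρ hρ]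
    · rw [if_neg (by rintro (h | h) <;> contradiction)]
      unfold plaquetteHolonomy
      rw [linkReflect_apply_of_ne _ _ _ _ hi, linkReflect_apply_of_ne _ _ _ _ hj,
        linkReflect_apply_of_ne _ _ _ _ hi, linkReflect_apply_of_ne _ _ _ _ hj,
        siteReflect_shift_of_ne _ _ hi, siteReflect_shift_of_ne _ _ hj]

/-- ★ **The Wilson action is invariant under every axis parity**: `S_W(πU) = S_W(U)` — the sum over
plaquettes is reindexed by the involution `plaqReflect`. Hence the Wilson weight `e^{-β S_W}` (and
every weight that is a function of it) satisfies the hypothesis `hw` of the measure-level theorems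
below. -/
theorem wilsonAction_linkReflect [TopologicalSpace G] [IsTopologicalGroup G] [CompactSpace G]
    [NeZero L] {n : ℕ} (ρ : G →* Matrix (Fin n) (Fin n) ℂ) (hρ : Continuous ρ)
    (U : GaugeConfig d L G) : wilsonAction ρ (linkReflect L ν a U) = wilsonAction ρ U := by
  unfold wilsonAction
  simp_rw [re_trace_plaquetteHolonomy_linkReflect ν a ρ hρ U]
  exact Equiv.sum_comp (plaqReflectEquiv L ν a)
    (fun p : Plaquette d L => ((n : ℝ) - (ρ (plaquetteHolonomy U p.1 p.2.1.1 p.2.1.2)).trace.re))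

end Wilson

/-! ## Part II — measure level: the blocked densities of a parity-invariant weight are parity
invariant (Bałaban's `T` commutes with parity) -/

section MeasureLevel

open MeasureTheory

/-- The underlying map of links: `(x, ν) ↦ (σ_{a-1} x, ν)`, `(x, μ) ↦ (σ_a x, μ)` for `μ ≠ ν`. -/
def edgeReflect (L : ℕ) (ν : Fin d) (a : ZMod L) (e : Edge d L) : Edge d L :=
  if e.2 = ν then (siteReflect L ν (a - 1) e.1, ν) else (siteReflect L ν a e.1, e.2)

theorem edgeReflect_edgeReflect (e : Edge d L) : edgeReflect L ν a (edgeReflect L ν a e) = e := by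
  obtain ⟨x, μ⟩ := e
  by_cases hμ : μ = ν
  · subst hμ; simp [edgeReflect, siteReflect_siteReflect]
  · simp [edgeReflect, hμ, siteReflect_siteReflect]

/-- `linkReflect` = relabel the links by `edgeReflect`, then invert the ones in direction `ν`. -/
theorem linkReflect_eq [Group G] (U : GaugeConfig d L G) (e : Edge d L) :
    linkReflect L ν a U e =
      if e.2 = ν then (U (edgeReflect L ν a e))⁻¹ else U (edgeReflect L ν a e) := by
  obtain ⟨x, μ⟩ := e
  by_cases hμ : μ = ν
  · subst hμ; simp [linkReflect, edgeReflect]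
  · simp [linkReflect, edgeReflect, hμ]

/-- `edgeReflect` as a permutation of the links (it is an involution). -/
def edgeReflectEquiv (L : ℕ) (ν : Fin d) (a : ZMod L) : Equiv.Perm (Edge d L) :=
  Function.Involutive.toPerm (edgeReflect L ν a) (edgeReflect_edgeReflect ν a)

variable [Group G] [MeasurableSpace G] [TopologicalSpace G] [IsTopologicalGroup G] [BorelSpace G]

/-- The parity of gauge fields is measurable. -/
theorem measurable_linkReflect :
    Measurable (linkReflect L ν a : GaugeConfig d L G → GaugeConfig d L G) := by
  refine measurable_pi_lambda _ fun e => ?_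
  simp only [linkReflect_eq]
  split_ifs
  · exact (measurable_pi_apply _).inv
  · exact measurable_pi_apply _

/-- The parity of gauge fields as a measurable equivalence (a measurable involution). -/
def linkReflectMEquiv (L : ℕ) (ν : Fin d) (a : ZMod L) : GaugeConfig d L G ≃ᵐ GaugeConfig d L G where
  toFun := linkReflect L ν a
  invFun := linkReflect L ν a
  left_inv := linkReflect_linkReflect ν a
  right_inv := linkReflect_linkReflect ν a
  measurable_toFun := measurable_linkReflect ν a
  measurable_invFun := measurable_linkReflect ν a

@[simp] theorem linkReflectMEquiv_apply (U : GaugeConfig d L G) :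
    linkReflectMEquiv (G := G) L ν a U = linkReflect L ν a U := rfl

variable [CompactSpace G]

/-- **Parity preserves the product Haar measure** `∏ₑ dU_e` of the torus: it relabels the links by
an involution and inverts those in direction `ν`, and the Haar probability measure of the compact
group `G` is inversion invariant (the tree's proof of `measurePreserving_timeReflect`, verbatim for a
general axis and centre). -/
theorem measurePreserving_linkReflect [NeZero L] :
    MeasurePreserving (linkReflect L ν a : GaugeConfig d L G → GaugeConfig d L G)
      (torusLinkHaar d G L) (torusLinkHaar d G L) := by
  have h1 : MeasurePreserving
      (MeasurableEquiv.arrowCongr' (edgeReflectEquiv (d := d) L ν a) (MeasurableEquiv.refl G))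
      (torusLinkHaar d G L) (torusLinkHaar d G L) :=
    measurePreserving_arrowCongr' (fun _ => haarProbability G) (fun _ => haarProbability G)
      (edgeReflectEquiv L ν a) (MeasurableEquiv.refl G) fun _ => MeasurePreserving.id _
  have h2 : MeasurePreserving
      (fun (V : GaugeConfig d L G) (e : Edge d L) =>
        (if e.2 = ν then (fun g : G => g⁻¹) else id) (V e))
      (torusLinkHaar d G L) (torusLinkHaar d G L) := by
    refine measurePreserving_pi _ _ fun e => ?_
    split_ifs
    · exact Measure.measurePreserving_inv _
    · exact MeasurePreserving.id _
  have heq : (linkReflect L ν a : GaugeConfig d L G → GaugeConfig d L G) =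
      (fun (V : GaugeConfig d L G) (e : Edge d L) =>
        (if e.2 = ν then (fun g : G => g⁻¹) else id) (V e)) ∘
      (MeasurableEquiv.arrowCongr' (edgeReflectEquiv (d := d) L ν a) (MeasurableEquiv.refl G)) := by
    funext U e
    have happ : (MeasurableEquiv.arrowCongr' (edgeReflectEquiv (d := d) L ν a)
        (MeasurableEquiv.refl G)) U e = U (edgeReflect L ν a e) := rfl
    simp only [Function.comp_apply, linkReflect_eq, happ]
    split_ifs <;> rfl
  rw [heq]
  exact h2.comp h1

variable {Nf M : ℕ} [NeZero Nf] [NeZero M]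

/-- **Blocked densities inherit intertwined symmetries** (abstract form).  If the blocking `Bl`
intertwines a symmetry `πf` of the fine torus (preserving `∏ dU_e` and the weight `w`) with a
measurable map `πb` of the block torus, `Bl ∘ πf = πb ∘ Bl`, then every blocked density `σ` of `w`
gives a `πb`-INVARIANT block measure `σ dV`: `∫ G(πb V) σ(V) dV = ∫ G(V) σ(V) dV` — in the tree's
language, `σ` is its own blocked density through `πb`. -/
theorem hasBlockedDensity_self_of_semiconj {Bl : GaugeConfig d Nf G → GaugeConfig d M G}
    {w : GaugeConfig d Nf G → ℝ} {σ : GaugeConfig d M G → ℝ} (h : HasBlockedDensity Bl w σ)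
    (πf : GaugeConfig d Nf G ≃ᵐ GaugeConfig d Nf G) {πb : GaugeConfig d M G → GaugeConfig d M G}
    (hπf : MeasurePreserving πf (torusLinkHaar d G Nf) (torusLinkHaar d G Nf)) (hπb : Measurable πb)
    (hBl : ∀ U, Bl (πf U) = πb (Bl U)) (hw : ∀ U, w (πf U) = w U) :
    HasBlockedDensity πb σ σ := by
  intro Gf hGf hC
  obtain ⟨C, hC⟩ := hC
  have h1 := h (Gf ∘ πb) (hGf.comp hπb) ⟨C, fun V => hC _⟩
  have h2 := h Gf hGf ⟨C, hC⟩
  simp only [Function.comp_apply] at h1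
  rw [← h1, ← h2]
  have h3 : ∫ U, Gf (Bl (πf U)) * w (πf U) ∂torusLinkHaar d G Nf =
      ∫ U, Gf (Bl U) * w U ∂torusLinkHaar d G Nf :=
    hπf.integral_comp' (fun U' => Gf (Bl U') * w U')
  simpa only [hBl, hw] using h3

/-- … and if `πb` is itself a `∏ dV_e`-preserving involution, the reflected density `σ ∘ πb` is
again a blocked density of `w` (so it agrees with `σ` almost everywhere, blocked densities being
determined by the blocked-weight identity): **the renormalization transformation commutes with the
symmetry.** -/
theorem hasBlockedDensity_comp_of_semiconj {Bl : GaugeConfig d Nf G → GaugeConfig d M G}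
    {w : GaugeConfig d Nf G → ℝ} {σ : GaugeConfig d M G → ℝ} (h : HasBlockedDensity Bl w σ)
    (πf : GaugeConfig d Nf G ≃ᵐ GaugeConfig d Nf G) (πb : GaugeConfig d M G ≃ᵐ GaugeConfig d M G)
    (hπf : MeasurePreserving πf (torusLinkHaar d G Nf) (torusLinkHaar d G Nf))
    (hπb : MeasurePreserving πb (torusLinkHaar d G M) (torusLinkHaar d G M))
    (hπb2 : ∀ V, πb (πb V) = V)
    (hBl : ∀ U, Bl (πf U) = πb (Bl U)) (hw : ∀ U, w (πf U) = w U) :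
    HasBlockedDensity Bl w (σ ∘ πb) := by
  intro Gf hGf hC
  obtain ⟨C, hC⟩ := hC
  have hinv := hasBlockedDensity_self_of_semiconj h πf hπf πb.measurable hBl hw Gf hGf ⟨C, hC⟩
  have h2 := h Gf hGf ⟨C, hC⟩
  rw [h2, ← hinv]
  have h3 : ∫ V, Gf (πb (πb V)) * σ (πb V) ∂torusLinkHaar d G M =
      ∫ V, Gf (πb V) * σ V ∂torusLinkHaar d G M :=
    hπb.integral_comp' (fun V' => Gf (πb V') * σ V')
  rw [← h3]
  congr 1
  funext V
  simp only [Function.comp_apply, hπb2]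

/-- ★★ **Parity of the blocked densities of the E1 tower** («evenness for free», card
`parity-valley-regularity` (B1), pre-vet (V7)).  Let `b (T-1) ≤ N` and let `w` be a weight on the
fine torus invariant under the parity `π_N = linkReflect N ν (b(T-1))` (e.g. the Wilson weight
`e^{-β S_W}`, or any function of plaquette traces symmetric under the lattice's point group).  Then
for every blocked density `σ` of `w` through the uneven axial blocking `Ū = unevenAxialLink b N T`
(Bałaban's `(Tρ)(V) = ∫ dU δ(Ū(U) V⁻¹) ρ(U)` in the tree's weak form `HasBlockedDensity`):
(i) the block measure `σ dV` is invariant under the block parity `π_T = linkReflect T ν (T-1)`;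
(ii) `σ ∘ π_T` is again a blocked density of `w` through `Ū`.
Iterating down the tower, every effective density is parity-even, in every axis direction `ν`. -/
theorem hasBlockedDensity_unevenAxialLink_parity {b N T : ℕ} [NeZero N] [NeZero T]
    (hN : b * (T - 1) ≤ N) (ν : Fin d) {w : GaugeConfig d N G → ℝ} {σ : GaugeConfig d T G → ℝ}
    (hw : ∀ U, w (linkReflect N ν ((b * (T - 1) : ℕ) : ZMod N) U) = w U)
    (h : HasBlockedDensity (unevenAxialLink b N T) w σ) :
    HasBlockedDensity (linkReflect T ν ((T - 1 : ℕ) : ZMod T)) σ σ ∧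
    HasBlockedDensity (unevenAxialLink b N T) w (σ ∘ linkReflect T ν ((T - 1 : ℕ) : ZMod T)) :=
  ⟨hasBlockedDensity_self_of_semiconj h (linkReflectMEquiv N ν _)
      (measurePreserving_linkReflect ν _) (measurable_linkReflect ν _)
      (unevenAxialLink_linkReflect hN ν) hw,
   hasBlockedDensity_comp_of_semiconj h (linkReflectMEquiv N ν _) (linkReflectMEquiv T ν _)
      (measurePreserving_linkReflect ν _) (measurePreserving_linkReflect ν _)
      (linkReflect_linkReflect ν _) (unevenAxialLink_linkReflect hN ν) hw⟩

/-- ★★ **The Wilson case, unconditionally**: for the Wilson weight `e^{-β S_W}` of a continuous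
matrix representation `ρ` of the compact group `G` (hypothesis `hw` discharged by
`wilsonAction_linkReflect`), every blocked density through the uneven axial blocking is parity
invariant in the sense (i) ∧ (ii), in every axis direction. -/
theorem hasBlockedDensity_wilson_parity {b N T : ℕ} [NeZero N] [NeZero T]
    (hN : b * (T - 1) ≤ N) (ν : Fin d) {n : ℕ} (ρ : G →* Matrix (Fin n) (Fin n) ℂ)
    (hρ : Continuous ρ) (β : ℝ) {σ : GaugeConfig d T G → ℝ}
    (h : HasBlockedDensity (unevenAxialLink b N T) (fun U => Real.exp (-β * wilsonAction ρ U)) σ) :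
    HasBlockedDensity (linkReflect T ν ((T - 1 : ℕ) : ZMod T)) σ σ ∧
    HasBlockedDensity (unevenAxialLink b N T) (fun U => Real.exp (-β * wilsonAction ρ U))
      (σ ∘ linkReflect T ν ((T - 1 : ℕ) : ZMod T)) :=
  hasBlockedDensity_unevenAxialLink_parity hN ν
    (fun U => by simp only [wilsonAction_linkReflect _ _ ρ hρ]) h

end MeasureLevel

end Summit.QuantumFields.YangMills.Cruxes.TwistedTraceScaling.ParityBlocking
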